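import Summits.QuantumFields.BalabanUV.InfraRed.StrongCouplingSlabAxialRows
import Summits.QuantumFields.BalabanUV.InfraRed.StrongCouplingQuarterModulusFourFifteenths
import Literature.MathematicalPhysics.QuantumFieldTheory.Balaban1983to89.MassGapOpenBoundaryLipschitz
import HarnessLib

/-!
# Strong coupling, temporal axial gauge on the open-time slab — SC-c for `SU(2)` on the CLOSED window `0 ≤ β_W ≤ 4/15`
(part 5 of 5: exponential clustering in time at Dobrushin constant `14`, and the doors)

**observatory of the non-perturbative crossover; no mass-gap claim.**  Cell `pub-balaban`, build IR-3 v2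
(two-front crossover ledger), IR-SC lineage, generation 13.  Currency SC-c of the ledger is the tree's
`CrossoverLedger.LatticeMassGap ρ β m` (`0 < m` and a Wilson transfer-operator gap `≥ m` on every spatial torus
`(ℤ/(2S+1))³`, `S ≥ S₀`).  Nothing here is a statement about `β_W > 4/15`, the crossover, scaling or the continuum;
the rate `krRate c` is the Dobrushin rate of the method, not a physical mass; no statement of the manuscripts under
audit (Bałaban, CMP 1983–89) is used or adjudicated.

THE DOOR.  The tree's `StrongCouplingOpenWindow` §8 proves exponential clustering in time of the `SU(N)` open chain from
the Kantorovich–Rubinstein one-link modulus `OneLinkKRModulus N R K` when `18 (|β|/N) K < 1` (Dobrushin rows of the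
slab: `3 · wdeg ≤ 18`).  Here the SAME estimate is run in the COMPLETE TEMPORAL AXIAL GAUGE (parts 1–4): for
gauge-invariant slice observables the slab Gibbs expectation equals the expectation in the weight measure of the FROZEN
energy (all temporal links set to `1`, `StrongCouplingSlabAxialGauge.integral_weightMeasure_eq_frozen` — Creutz, Ch. 9,
eq. (9.19)), and the frozen weight specification is a Dobrushin contraction with rows `≤ 14 (|β|/N) K`
(`StrongCouplingSlabAxialRows.sum_nbr_frozenCoeff_slab_le`); Föllmer's covariance estimate
(`StrongCouplingFrozenPlaqKR.abs_integral_mul_sub_le_frozen_su`) then gives `OpenBoundaryTimeClustering` at rate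
`krRate c`, `c = 14 (|β|/N) K < 1`, for the class of GAUGE-INVARIANT bounded measurable observables — which is the class
the tree's Lipschitz conversion `transferOperatorGap_of_openBoundaryLipschitzClustering` (`MassGapOpenBoundaryLipschitz`)
consumes.  Consequences: `LatticeMassGap (fundamentalRep (Fin N)) β (krRate …)` for `0 ≤ β < N/40` (tree: `N/48`), and
for `SU(2)` with the landed quarter modulus `OneLinkKRModulusSU2 β_W (1/4)` on `β_W ≤ 4/15`
(`StrongCouplingQuarterModulusFourFifteenths`): **SC-c on the closed window `0 ≤ β_W ≤ 4/15`** at rate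
`krRate (7 β_W / 2)` (`= −log (14/15) = 0.0690` at `β_W = 4/15`, Wilson `β_W = 4/g²`, tree coupling `β_W/2`).

Every statement is kernel-checked; every hypothesis of every door is discharged inside the tree.  References (method
only): [cite: Follmer1988, Thm. (2.13) and Remark (2.17)] [cite: Georgii2011, Prop. 8.8, Thm. 8.7, (8.20)]
[cite: Creutz2022, Ch. 9, eq. (9.19), p. 44] [cite: LuscherSchaefer2011, §2.4, §2.5]
[cite: MontvayMunster1994, §3.2.6 (3.140)] [cite: arXiv220412737, §1 and §4].
-/

noncomputable section

open MeasureTheory ProbabilityTheory Filter Function Finset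
open scoped NNReal
open Literature.Probability.LatticeModels
open Literature.Probability.LatticeModels.DobrushinMetric
open Literature.MathematicalPhysics.QuantumLattice (fundamentalRep fundamentalLatticeRep continuous_fundamentalRep
  fundamentalRep_injective fundamentalRep_mem_unitaryGroup)
open Literature.MathematicalPhysics.QuantumFieldTheory
open Literature.MathematicalPhysics.QuantumFieldTheory.Balaban1983to89
open Literature.MathematicalPhysics.QuantumFieldTheory.Balaban1983to89.StrongCouplingDobrushinWindow
open Literature.MathematicalPhysics.QuantumFieldTheory.Balaban1983to89.StrongCouplingTorusWindow
open Literature.MathematicalPhysics.QuantumFieldTheory.Balaban1983to89.StrongCouplingKernelWindow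
open Literature.MathematicalPhysics.QuantumFieldTheory.Balaban1983to89.StrongCouplingOpenWindow
open Literature.MathematicalPhysics.QuantumFieldTheory.Balaban1983to89.StrongCouplingOpenWindow.PlaqSystem (suWeight
  continuous_suWeight suSmoothLip suSmoothLip_nonneg)
open Literature.MathematicalPhysics.QuantumFieldTheory.Balaban1983to89.Sufficient
open Literature.MathematicalPhysics.QuantumFieldTheory.Balaban1983to89.Sufficient.OpenBoundary
open Summit.QuantumFields.BalabanUV.InfraRed.StrongCouplingFrozenPlaqSpec
open Summit.QuantumFields.BalabanUV.InfraRed.StrongCouplingFrozenPlaqKR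
open Summit.QuantumFields.BalabanUV.InfraRed.StrongCouplingSlabAxialGauge
open Summit.QuantumFields.BalabanUV.InfraRed.StrongCouplingSlabAxialRows
open Summit.QuantumFields.BalabanUV.InfraRed.StrongCouplingQuarterModulusFourFifteenths
  (oneLinkKRModulusSU2_of_le_fourFifteenths)

namespace Summit.QuantumFields.BalabanUV.InfraRed.StrongCouplingSlabAxialClustering

/-! ### §1 Exponential clustering in time of gauge-invariant slice observables at Dobrushin constant `14` -/

section Clustering

variable {L T : ℕ} [NeZero L] (hL : 1 < L)

include hL in
/-- **Exponential clustering in time of the `SU(N)` open chain, in the temporal axial gauge**: if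
`OneLinkKRModulus N R K` with `6|β|/N ≤ R` and `c = 14 (|β|/N) K < 1`, then on every spatial torus `(ℤ/L)³`, `L ≥ 2`,
every GAUGE-INVARIANT bounded measurable slice observable `f` has
`|⟨f(U_s) f(U_{s+t})⟩ − ⟨f(U_s)⟩⟨f(U_{s+t})⟩| ≤ K_f e^{−m t}` in the open chain of any length `T ≥ s + t`, with
`m = krRate c` and `K_f` independent of `T, s, t` (the tree's §8 constant).  Proof: the tree's §7 identification, the
axial gauge-fixing identity of part 3, Föllmer's estimate for the frozen weight specification (part 2) with the rows of
part 4. [cite: Follmer1988, Thm. (2.13) and Remark (2.17)] [cite: Creutz2022, Ch. 9, eq. (9.19), p. 44] -/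
theorem openBoundaryTimeClustering_of_oneLinkKRModulus_axial {N : ℕ} (hN : 1 ≤ N) {β R K c : ℝ} (hK : 0 ≤ K)
    (hR : |β| / N * 6 ≤ R) (hmod : OneLinkKRModulus N R K) (hc : 14 * (|β| / N) * K ≤ c) (hc1 : c < 1) :
    OpenBoundaryTimeClustering (fundamentalRep (Fin N)) β L
      {f : GaugeConfig 3 L (Matrix.specialUnitaryGroup (Fin N) ℂ) → ℝ |
        IsGaugeInvariant f ∧ Measurable f ∧ ∃ B : ℝ, ∀ U, |f U| ≤ B}
      (krRate c) := by
  haveI : SecondCountableTopology (Matrix (Fin N) (Fin N) ℂ) :=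
    inferInstanceAs (SecondCountableTopology (Fin N → Fin N → ℂ))
  haveI : SecondCountableTopology (Matrix.specialUnitaryGroup (Fin N) ℂ) :=
    Topology.IsEmbedding.subtypeVal.secondCountableTopology
  unfold OpenBoundaryTimeClustering
  rintro f ⟨hfg, hfm, M, hM⟩
  have hM0 : 0 ≤ M := (abs_nonneg _).trans (hM fun _ => 1)
  have hρc : Continuous (fundamentalRep (Fin N)) := continuous_fundamentalRep (Fin N)
  -- constants
  have hc'1 : max c (1 / 2) ≤ 1 := max_le hc1.le (by norm_num)
  have hc'h : 1 / 2 ≤ max c (1 / 2) := le_max_right _ _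
  have hc'0 : 0 < max c (1 / 2) := lt_of_lt_of_le (by norm_num) hc'h
  have hcc' : 14 * (|β| / N) * K ≤ max c (1 / 2) := hc.trans (le_max_left _ _)
  have hE0 : 0 ≤ suSmoothLip N 6 β := suSmoothLip_nonneg hN (by norm_num) β
  have hME : 0 ≤ M * suSmoothLip N 6 β := mul_nonneg hM0 hE0
  have hA0 : 0 ≤ 2 * (2 * Real.sqrt N) ^ 2 *
      (((3 * Fintype.card (Edge 3 L) + 2 * Fintype.card (Site 3 L) : ℕ) : ℝ) * (M * suSmoothLip N 6 β)) *
      (((3 * Fintype.card (Edge 3 L) + 2 * Fintype.card (Site 3 L) : ℕ) : ℝ) * (4 * (M * suSmoothLip N 6 β))) :=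
    mul_nonneg (mul_nonneg (by positivity) (mul_nonneg (Nat.cast_nonneg _) hME))
      (mul_nonneg (Nat.cast_nonneg _) (mul_nonneg (by norm_num) hME))
  refine ⟨2 * (2 * Real.sqrt N) ^ 2 *
      (((3 * Fintype.card (Edge 3 L) + 2 * Fintype.card (Site 3 L) : ℕ) : ℝ) * (M * suSmoothLip N 6 β)) *
      (((3 * Fintype.card (Edge 3 L) + 2 * Fintype.card (Site 3 L) : ℕ) : ℝ) * (4 * (M * suSmoothLip N 6 β))) +
      4 * M ^ 2, fun T s t ht hst => ?_⟩
  have hsT : s < T + 1 := by omega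
  have hstT : s + t < T + 1 := by omega
  -- the slab Gibbs measure, the identification of the tree's §7, and the frozen (axially gauged) measure
  have hEm := (slab (T := T) hL).measurable_energy (G := Matrix.specialUnitaryGroup (Fin N) ℂ)
    (continuous_repWeight hρc β)
  obtain ⟨C, hC⟩ := exists_abs_le_of_continuous ((slab (T := T) hL).continuous_energy
    (G := Matrix.specialUnitaryGroup (Fin N) ℂ) (continuous_repWeight hρc β))
  have hG := isGibbsMeasure_weightMeasure hEm ⟨C, hC⟩
  haveI : IsProbabilityMeasure
      (weightMeasure ((slab (T := T) hL).energy (repWeight (fundamentalRep (Fin N)) β))) :=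
    hG.isProbabilityMeasure
  have hGf := isGibbsMeasure_weightMeasure
    (measurable_frozenEnergy (slab (T := T) hL) (temporalLinks L T)
      (G := Matrix.specialUnitaryGroup (Fin N) ℂ) (continuous_suWeight (N := N) β))
    (exists_abs_frozenEnergy_le (slab (T := T) hL) (temporalLinks L T)
      (G := Matrix.specialUnitaryGroup (Fin N) ℂ) (continuous_suWeight (N := N) β))
  haveI : IsProbabilityMeasure (frozenSuMeasure (slab (T := T) hL) (temporalLinks L T) N β) :=
    hGf.isProbabilityMeasure
  have hμ : frozenSuMeasure (slab (T := T) hL) (temporalLinks L T) N β =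
      weightMeasure fun σ => (slab (T := T) hL).energy (repWeight (fundamentalRep (Fin N)) β)
        (freezeOn (temporalLinks L T) σ) := by
    unfold frozenSuMeasure
    rw [suWeight_eq_repWeight]
    rfl
  have hEinv : ∀ (h : Fin (T + 1) → Site 3 L → Matrix.specialUnitaryGroup (Fin N) ℂ)
      (σ : SlabLink L T → Matrix.specialUnitaryGroup (Fin N) ℂ),
      (slab (T := T) hL).energy (repWeight (fundamentalRep (Fin N)) β) (slabGauge h σ) =
        (slab (T := T) hL).energy (repWeight (fundamentalRep (Fin N)) β) σ :=
    energy_repWeight_slabGauge hL _ β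
  have hsm : ∀ (A : Finset ℕ) (t' : Fin (T + 1)), Measurable (sliceObs L T f A t') := fun A t' => by
    unfold sliceObs
    split_ifs
    exacts [hfm, measurable_const]
  have hsb : ∀ (A : Finset ℕ) (t' : Fin (T + 1)) (U : GaugeConfig 3 L (Matrix.specialUnitaryGroup (Fin N) ℂ)),
      |sliceObs L T f A t' U| ≤ max M 1 := fun A t' U => by
    rw [sliceObs_apply]
    split_ifs
    · exact (hM U).trans (le_max_left _ _)
    · rw [abs_one]; exact le_max_right _ _
  -- the two observables on the slab: measurable, bounded, gauge invariant, blind to the temporal links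
  have hm1 : Measurable fun σ : SlabLink L T → Matrix.specialUnitaryGroup (Fin N) ℂ => f (slices σ ⟨s, hsT⟩) :=
    hfm.comp ((measurable_pi_apply _).comp measurable_slices)
  have hm2 : Measurable fun σ : SlabLink L T → Matrix.specialUnitaryGroup (Fin N) ℂ =>
      f (slices σ ⟨s + t, hstT⟩) :=
    hfm.comp ((measurable_pi_apply _).comp measurable_slices)
  have hMf : ∀ σ : SlabLink L T → Matrix.specialUnitaryGroup (Fin N) ℂ, |f (slices σ ⟨s, hsT⟩)| ≤ M :=
    fun σ => hM _
  have hMg : ∀ σ : SlabLink L T → Matrix.specialUnitaryGroup (Fin N) ℂ, |f (slices σ ⟨s + t, hstT⟩)| ≤ M :=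
    fun σ => hM _
  have hE2 : openExpectation (fundamentalRep (Fin N)) β L T (sliceObs L T f {s, s + t}) =
      ∫ σ, f (slices σ ⟨s, hsT⟩) * f (slices σ ⟨s + t, hstT⟩)
        ∂(frozenSuMeasure (slab (T := T) hL) (temporalLinks L T) N β) := by
    rw [openExpectation_eq_integral_weightMeasure hL hρc β T (hsm _) (hsb _), hμ]
    refine (integral_congr_ae (ae_of_all _ fun σ => prod_sliceObs_pair ht hsT hstT f (slices σ))).trans ?_
    exact integral_weightMeasure_eq_frozen hEm hC hEinv (hm1.mul hm2) (abs_mul_le_of_abs_le hMf hMg)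
      (fun h σ => congrArg₂ (· * ·) (hfg (h ⟨s, hsT⟩) (slices σ ⟨s, hsT⟩))
        (hfg (h ⟨s + t, hstT⟩) (slices σ ⟨s + t, hstT⟩)))
      (fun σ => by simp only [slices_freezeOn'])
  have hEs : openExpectation (fundamentalRep (Fin N)) β L T (sliceObs L T f {s}) =
      ∫ σ, f (slices σ ⟨s, hsT⟩) ∂(frozenSuMeasure (slab (T := T) hL) (temporalLinks L T) N β) := by
    rw [openExpectation_eq_integral_weightMeasure hL hρc β T (hsm _) (hsb _), hμ]
    refine (integral_congr_ae (ae_of_all _ fun σ => prod_sliceObs_singleton hsT f (slices σ))).trans ?_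
    exact integral_weightMeasure_eq_frozen hEm hC hEinv hm1 hMf
      (fun h σ => hfg (h ⟨s, hsT⟩) (slices σ ⟨s, hsT⟩)) (fun σ => by simp only [slices_freezeOn'])
  have hEst : openExpectation (fundamentalRep (Fin N)) β L T (sliceObs L T f {s + t}) =
      ∫ σ, f (slices σ ⟨s + t, hstT⟩) ∂(frozenSuMeasure (slab (T := T) hL) (temporalLinks L T) N β) := by
    rw [openExpectation_eq_integral_weightMeasure hL hρc β T (hsm _) (hsb _), hμ]
    refine (integral_congr_ae (ae_of_all _ fun σ => prod_sliceObs_singleton hstT f (slices σ))).trans ?_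
    exact integral_weightMeasure_eq_frozen hEm hC hEinv hm2 hMg
      (fun h σ => hfg (h ⟨s + t, hstT⟩) (slices σ ⟨s + t, hstT⟩)) (fun σ => by simp only [slices_freezeOn'])
  have hexp : Real.exp (-(krRate c * (t : ℝ))) = max c (1 / 2) ^ t := by
    rw [krRate, neg_mul, neg_neg, mul_comm, Real.exp_nat_mul, Real.exp_log hc'0]
  rw [hE2, hEs, hEst, hexp]
  -- the trivial bound
  have htriv : |(∫ σ, f (slices σ ⟨s, hsT⟩) * f (slices σ ⟨s + t, hstT⟩)
        ∂(frozenSuMeasure (slab (T := T) hL) (temporalLinks L T) N β)) -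
      (∫ σ, f (slices σ ⟨s, hsT⟩) ∂(frozenSuMeasure (slab (T := T) hL) (temporalLinks L T) N β)) *
      ∫ σ, f (slices σ ⟨s + t, hstT⟩) ∂(frozenSuMeasure (slab (T := T) hL) (temporalLinks L T) N β)| ≤
      2 * M ^ 2 :=
    calc _ ≤ |∫ σ, f (slices σ ⟨s, hsT⟩) * f (slices σ ⟨s + t, hstT⟩)
              ∂(frozenSuMeasure (slab (T := T) hL) (temporalLinks L T) N β)| +
            |(∫ σ, f (slices σ ⟨s, hsT⟩) ∂(frozenSuMeasure (slab (T := T) hL) (temporalLinks L T) N β)) *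
              ∫ σ, f (slices σ ⟨s + t, hstT⟩) ∂(frozenSuMeasure (slab (T := T) hL) (temporalLinks L T) N β)| :=
          abs_sub _ _
      _ ≤ M * M + M * M := by
          refine add_le_add (abs_integral_le_of_abs_le (abs_mul_le_of_abs_le hMf hMg)) ?_
          rw [abs_mul]
          exact mul_le_mul (abs_integral_le_of_abs_le hMf) (abs_integral_le_of_abs_le hMg) (abs_nonneg _) hM0
      _ = 2 * M ^ 2 := by ring
  rcases Nat.lt_or_ge t 2 with ht2 | ht2
  · -- `t = 1`
    have ht1 : t = 1 := by omega
    rw [show max c (1 / 2) ^ t = max c (1 / 2) by rw [ht1, pow_one]]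
    refine htriv.trans ?_
    nlinarith [mul_nonneg hA0 hc'0.le, mul_nonneg (sq_nonneg M) (sub_nonneg.2 hc'h)]
  · -- `t ≥ 2`: Föllmer's estimate for the frozen weight specification on the slab (rows `≤ 14 (|β|/N) K ≤ c'`)
    have hsep : ∀ y ∈ (slab (T := T) hL).closure (sliceLinks ⟨s, hsT⟩), y ∉ sliceLinks ⟨s + t, hstT⟩ :=
      fun y hy => not_mem_sliceLinks_of_mem_closure hL (by simp only; omega) hy
    have hrow : ∀ v, ∑ y ∈ (slab (T := T) hL).nbr v,
        frozenCoeff (slab (T := T) hL) (N := N) (temporalLinks L T) K β v y ≤ max c (1 / 2) :=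
      fun v => (sum_nbr_frozenCoeff_slab_le hL N hK β v).trans hcc'
    have key := abs_integral_mul_sub_le_frozen_su (slab (T := T) hL) (temporalLinks L T) hN hK (by norm_num)
      (wdeg_slab_le hL) hR hmod hrow hc'0.le hc'1 hm1 (dependsOn_slices f ⟨s, hsT⟩) hMf hm2
      (dependsOn_slices f ⟨s + t, hstT⟩) hMg hsep (sliceProfile (s + t))
      (fun y hy => sliceProfile_eq_zero_of_mem_closure hL hy) (fun x _ y hy => sliceProfile_nbr hL (s + t) hy)
    have hsum1 : ∑ _y ∈ (slab (T := T) hL).closure (sliceLinks ⟨s + t, hstT⟩), M * suSmoothLip N 6 β ≤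
        ((3 * Fintype.card (Edge 3 L) + 2 * Fintype.card (Site 3 L) : ℕ) : ℝ) * (M * suSmoothLip N 6 β) := by
      rw [Finset.sum_const, nsmul_eq_mul]
      exact mul_le_mul_of_nonneg_right (by exact_mod_cast card_closure_sliceLinks_le hL _) hME
    have hsum2 : ∑ y ∈ (slab (T := T) hL).closure (sliceLinks ⟨s, hsT⟩),
        max c (1 / 2) ^ sliceProfile (s + t) y * (M * suSmoothLip N 6 β) ≤
        ((3 * Fintype.card (Edge 3 L) + 2 * Fintype.card (Site 3 L) : ℕ) : ℝ) *
          (max c (1 / 2) ^ (t - 2) * (M * suSmoothLip N 6 β)) :=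
      calc ∑ y ∈ (slab (T := T) hL).closure (sliceLinks ⟨s, hsT⟩),
            max c (1 / 2) ^ sliceProfile (s + t) y * (M * suSmoothLip N 6 β)
          ≤ ∑ _y ∈ (slab (T := T) hL).closure (sliceLinks ⟨s, hsT⟩),
              max c (1 / 2) ^ (t - 2) * (M * suSmoothLip N 6 β) := by
            refine Finset.sum_le_sum fun y hy => mul_le_mul_of_nonneg_right
              (pow_le_pow_of_le_one hc'0.le hc'1 ?_) hME
            have h := le_sliceProfile_of_mem_closure hL (s + t) hy
            simp only at h
            omega
        _ = ((slab (T := T) hL).closure (sliceLinks ⟨s, hsT⟩)).card *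
              (max c (1 / 2) ^ (t - 2) * (M * suSmoothLip N 6 β)) := by
            rw [Finset.sum_const, nsmul_eq_mul]
        _ ≤ _ := mul_le_mul_of_nonneg_right (by exact_mod_cast card_closure_sliceLinks_le hL _)
              (mul_nonneg (pow_nonneg hc'0.le _) hME)
    have hpow := pow_sub_two_le hc'h ht2
    calc _ ≤ _ := key
      _ ≤ 2 * (2 * Real.sqrt N) ^ 2 *
            (((3 * Fintype.card (Edge 3 L) + 2 * Fintype.card (Site 3 L) : ℕ) : ℝ) * (M * suSmoothLip N 6 β)) *
            (((3 * Fintype.card (Edge 3 L) + 2 * Fintype.card (Site 3 L) : ℕ) : ℝ) *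
              (max c (1 / 2) ^ (t - 2) * (M * suSmoothLip N 6 β))) :=
          mul_le_mul (mul_le_mul_of_nonneg_left hsum1 (by positivity)) hsum2
            (Finset.sum_nonneg fun y _ => mul_nonneg (pow_nonneg hc'0.le _) hME)
            (mul_nonneg (by positivity) (mul_nonneg (Nat.cast_nonneg _) hME))
      _ ≤ 2 * (2 * Real.sqrt N) ^ 2 *
            (((3 * Fintype.card (Edge 3 L) + 2 * Fintype.card (Site 3 L) : ℕ) : ℝ) * (M * suSmoothLip N 6 β)) *
            (((3 * Fintype.card (Edge 3 L) + 2 * Fintype.card (Site 3 L) : ℕ) : ℝ) *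
              (4 * max c (1 / 2) ^ t * (M * suSmoothLip N 6 β))) :=
          mul_le_mul_of_nonneg_left (mul_le_mul_of_nonneg_left (mul_le_mul_of_nonneg_right hpow hME)
            (Nat.cast_nonneg _)) (mul_nonneg (by positivity) (mul_nonneg (Nat.cast_nonneg _) hME))
      _ = 2 * (2 * Real.sqrt N) ^ 2 *
            (((3 * Fintype.card (Edge 3 L) + 2 * Fintype.card (Site 3 L) : ℕ) : ℝ) * (M * suSmoothLip N 6 β)) *
            (((3 * Fintype.card (Edge 3 L) + 2 * Fintype.card (Site 3 L) : ℕ) : ℝ) *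
              (4 * (M * suSmoothLip N 6 β))) * max c (1 / 2) ^ t := by ring
      _ ≤ _ := mul_le_mul_of_nonneg_right (le_add_of_nonneg_right (by positivity)) (pow_nonneg hc'0.le t)

end Clustering

/-! ### §2 The doors: transfer-operator gap and `LatticeMassGap` (currency SC-c) at Dobrushin constant `14` -/

section Doors

/-- **SC-c in the Kantorovich–Rubinstein window, temporal axial gauge**: under the hypotheses of
`openBoundaryTimeClustering_of_oneLinkKRModulus_axial` and `β ≥ 0`, the Wilson transfer matrix of `SU(N)` on the
spatial torus `(ℤ/(2S+1))³` has a simple top eigenvalue and a spectral gap `≥ krRate c`, for every `S ≥ 1` — by the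
tree's Lipschitz-class conversion `transferOperatorGap_of_openBoundaryLipschitzClustering` (gauge-invariant
`ρ`-Lipschitz time-zero functions are gauge-invariant, measurable and bounded). [folklore] -/
theorem transferOperatorGap_of_oneLinkKRModulus_axial {N : ℕ} (hN : 1 ≤ N) {β R K c : ℝ} (hK : 0 ≤ K)
    (hR : |β| / N * 6 ≤ R) (hmod : OneLinkKRModulus N R K) (hc : 14 * (|β| / N) * K ≤ c) (hc1 : c < 1)
    (hβ : 0 ≤ β) {S : ℕ} (hS : 1 ≤ S) : TransferOperatorGap (fundamentalRep (Fin N)) β S (krRate c) := by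
  haveI : SecondCountableTopology (Matrix (Fin N) (Fin N) ℂ) :=
    inferInstanceAs (SecondCountableTopology (Fin N → Fin N → ℂ))
  haveI : SecondCountableTopology (Matrix.specialUnitaryGroup (Fin N) ℂ) :=
    Topology.IsEmbedding.subtypeVal.secondCountableTopology
  refine transferOperatorGap_of_openBoundaryLipschitzClustering (continuous_fundamentalRep (Fin N))
    fundamentalRep_mem_unitaryGroup (fundamentalRep_injective (Fin N)) hβ S (fun F K' hFg hFK => ?_)
    (openBoundaryTimeClustering_of_oneLinkKRModulus_axial (L := 2 * S + 1) (by omega) hN hK hR hmod hc hc1)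
  obtain ⟨B, hB⟩ := exists_bound_of_isTimeZeroLipschitz (continuous_fundamentalRep (Fin N)) hFK
  exact ⟨hFg, measurable_of_isTimeZeroLipschitz (continuous_fundamentalRep (Fin N)) hFK, B,
    fun U => (Real.norm_eq_abs (F U)).symm.le.trans (hB U)⟩

/-- **`CrossoverLedger.LatticeMassGap` (currency SC-c) in the Kantorovich–Rubinstein window at Dobrushin constant `14`**:
a transfer-operator gap `≥ krRate c > 0` uniformly in the spatial volume `(2S+1)³`, `S ≥ 1`. [folklore] -/
theorem latticeMassGap_of_oneLinkKRModulus_axial {N : ℕ} (hN : 1 ≤ N) {β R K c : ℝ} (hK : 0 ≤ K)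
    (hR : |β| / N * 6 ≤ R) (hmod : OneLinkKRModulus N R K) (hc : 14 * (|β| / N) * K ≤ c) (hc1 : c < 1)
    (hβ : 0 ≤ β) : CrossoverLedger.LatticeMassGap (fundamentalRep (Fin N)) β (krRate c) :=
  ⟨krRate_pos hc1, 1, fun _ hS => transferOperatorGap_of_oneLinkKRModulus_axial hN hK hR hmod hc hc1 hβ hS⟩

/-- **SC-c for every `SU(N)`, `N ≥ 2`, hypothesis-free, from the Bakry–Émery one-link modulus** (`oneLinkKRModulus_SU`)
in the axial gauge: `LatticeMassGap (fundamentalRep (Fin N)) β (krRate (14 (β/N) / (1/2 − 6β/N)))` for `0 ≤ β < N/40`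
(tree coupling; the tree's un-gauged window is `β < N/48`). [folklore] -/
theorem latticeMassGap_SU_axial {N : ℕ} (hN : 2 ≤ N) {β : ℝ} (hβ0 : 0 ≤ β) (hβ : β < N / 40) :
    CrossoverLedger.LatticeMassGap (fundamentalRep (Fin N)) β
      (krRate (14 * (β / N) * (1 / (1 / 2 - β / N * 6)))) := by
  have hN0 : (0 : ℝ) < N := by exact_mod_cast (show 0 < N by omega)
  have hx : β / N < 1 / 40 := by
    rw [div_lt_iff₀ hN0]
    linarith
  have hRlt : β / N * 6 < 1 / 2 := by linarith
  have hpos : 0 < 1 / 2 - β / N * 6 := by linarith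
  have habs : |β| = β := abs_of_nonneg hβ0
  refine latticeMassGap_of_oneLinkKRModulus_axial (by omega) (R := β / N * 6) (K := 1 / (1 / 2 - β / N * 6))
    (one_div_pos.2 hpos).le (by rw [habs]) (oneLinkKRModulus_SU hN hRlt) (by rw [habs]) ?_ hβ0
  rw [← mul_div_assoc, mul_one, div_lt_one hpos]
  linarith

/-- **SC-c for `SU(2)` from any certified modulus `OneLinkKRModulusSU2 βW K₂` with `14 βW K₂ < 1`** (Wilson coupling
`βW = 4/g²`, tree coupling `βW/2`): `LatticeMassGap (fundamentalRep (Fin 2)) (βW/2) (krRate (14 βW K₂))`.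
[folklore] -/
theorem su2_latticeMassGap_of_oneLinkKRModulusSU2_axial {βW K₂ : ℝ} (h0 : 0 ≤ βW) (hK : 0 ≤ K₂)
    (hmod : OneLinkKRModulusSU2 βW K₂) (hwin : 14 * βW * K₂ < 1) :
    CrossoverLedger.LatticeMassGap (fundamentalRep (Fin 2)) (βW / 2) (krRate (14 * βW * K₂)) := by
  have habs : |βW / 2| = βW / 2 := abs_of_nonneg (by positivity)
  refine latticeMassGap_of_oneLinkKRModulus_axial (N := 2) (by norm_num) (R := 3 * βW / 2) (K := 4 * K₂)
    (by positivity) ?_ hmod ?_ hwin (by positivity)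
  · rw [habs]; push_cast; linarith
  · rw [habs]; push_cast; linarith

/-- **SC-c, `SU(2)`, `d = 4`, ON THE CLOSED WINDOW `0 ≤ β_W ≤ 4/15`, HYPOTHESIS-FREE** — the landed quarter modulus
`OneLinkKRModulusSU2 β_W (1/4)` (`StrongCouplingQuarterModulusFourFifteenths.oneLinkKRModulusSU2_of_le_fourFifteenths`)
through the axial-gauge door (`14 · β_W · ¼ ≤ 14/15 < 1`): a transfer-operator gap `≥ krRate (7β_W/2)`, uniformly in
the spatial volume.  Observatory of the non-perturbative crossover; no mass-gap claim beyond the strong-coupling window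
stated. [folklore] -/
theorem su2_latticeMassGap_axial_of_le_fourFifteenths {βW : ℝ} (h0 : 0 ≤ βW) (h415 : βW ≤ 4 / 15) :
    CrossoverLedger.LatticeMassGap (fundamentalRep (Fin 2)) (βW / 2) (krRate (14 * βW * (1 / 4))) :=
  su2_latticeMassGap_of_oneLinkKRModulusSU2_axial h0 (by norm_num) (oneLinkKRModulusSU2_of_le_fourFifteenths h415)
    (by linarith)

/-- **SC-c at the new ledger value `β_W = 4/15`** (`g² = 15`, tree coupling `2/15`; rate `krRate (14/15) = 0.0690`).
[folklore] -/
theorem su2_latticeMassGap_axial_fourFifteenths :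
    CrossoverLedger.LatticeMassGap (fundamentalRep (Fin 2)) ((4 / 15 : ℝ) / 2)
      (krRate (14 * (4 / 15 : ℝ) * (1 / 4))) :=
  su2_latticeMassGap_axial_of_le_fourFifteenths (by norm_num) le_rfl

/-- **SC-c at `β_W = 1/4`** (`g² = 16`, tree coupling `1/8`; rate `krRate (7/8) = 0.1335`). [folklore] -/
theorem su2_latticeMassGap_axial_quarter :
    CrossoverLedger.LatticeMassGap (fundamentalRep (Fin 2)) ((1 / 4 : ℝ) / 2)
      (krRate (14 * (1 / 4 : ℝ) * (1 / 4))) :=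
  su2_latticeMassGap_axial_of_le_fourFifteenths (by norm_num) (by norm_num)

end Doors

end Summit.QuantumFields.BalabanUV.InfraRed.StrongCouplingSlabAxialClustering
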